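import Summits.AtomisticToContinuum.Crystallization.Theorems.ChargedEnergyGapFrozenMoment
import HarnessLib

/-!
# ChargedEnergyGap · NODE 82 «LineMoment» (lens-3 g81) — file A of three: the cubic frame and the hole calculus on `ℤ³` (§L1), the leaf (LS)
`CubicFrameQ` (§L2), the line-excess table and the leaf (LB) `LineChargeQ` (§L3), the line pairs, the marked holes, `restLoad` / `lineLoad` /
`lineMoment` and the residual leaf (M_L) `LineMatchingQ'` (§L4)

Thesis, census, tags, the «why novel» sentence and the split (M_F) ⟸ (LS) ∧ (LB) ∧ (M_L): module docstring of `…Theorems.ChargedEnergyGapLineMoment`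
(file C: the split, the hole re-indexing, the dominations, THE GLUE `frozenMatchingQ'_of_line`, the designate and the cone
`chargedEnergyGap_of_lineMoment_numerics`); file B `…Theorems.ChargedEnergyGapLineMomentB` holds the frame lemmas and the two line constraints.
Line of record `stmt-AtomisticToContinuum-14231` (`Summit.AtomisticToContinuum.ChargedEnergyGap`); target = NODE 81's residual-deciding leaf (M_F)
`FrozenMatchingQ'` (tree `…ChargedEnergyGapFrozenMomentB`), VERBATIM.

Imports ONLY the tree file `…ChargedEnergyGapFrozenMoment` (NODE 81, hence NODE 79's `ballPool`, `pool`, `HeavyActive`, …) and `HarnessLib`; no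
`set_option`, no `sorry`, no instance, no notation, no `private`; namespace `…Theorems.ChargedEnergyGapChartDial`; new declaration names.
-/

noncomputable section

open scoped Classical
open Literature.MathematicalPhysics.StatisticalMechanics Literature.Geometry.DiscreteGeometry
open Summit.AtomisticToContinuum.Crystallization.Theses.PricedLinkCensus
open Summit.AtomisticToContinuum.Crystallization.Theorems.ChargedEnergyGapNegative

namespace Summit.AtomisticToContinuum.Crystallization.Theorems.ChargedEnergyGapChartDial

/-! ## §L1 The cubic frame and the hole calculus of a depth function on `ℤ³` -/

section HoleCalculus

/-- The point of integer coordinates `w` in the CUBIC FRAME `(c₀, f, ρ)`: `c₀ + Σᵢ (wᵢ ρ) • fᵢ` (in the cubic fcc reference with half-diagonal `ρ`: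
sites = even coordinate sum, octahedral holes = odd coordinate sum). -/
def cubicPt (c₀ : E3) (f : Fin 3 → E3) (ρ : ℝ) (w : Fin 3 → ℤ) : E3 :=
  c₀ + ∑ i, ((w i : ℝ) * ρ) • f i

/-- The unit integer vector of axis `a`. -/
def axisZ (a : Fin 3) : Fin 3 → ℤ := fun i => if i = a then 1 else 0

/-- The integer sign of a pole: `+1` for `true`, `−1` for `false` (the convention of `octVertex`). -/
def poleSign (b : Bool) : ℤ := if b then 1 else -1

/-- The lattice index of vertex `u = (a, b)` of the octahedron of the hole `w`: `w ± e_a`. -/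
def holeVertex (w : Fin 3 → ℤ) (u : Fin 3 × Bool) : Fin 3 → ℤ := w + poleSign u.2 • axisZ u.1

/-- ★ The MIN-DEPTH of the hole `w` for the depth function `d`: the least depth of its six vertices `w ± e_a`. -/
def hDepthMin (d : (Fin 3 → ℤ) → ℝ) (w : Fin 3 → ℤ) : ℝ :=
  Finset.univ.inf' Finset.univ_nonempty (fun u : Fin 3 × Bool => d (holeVertex w u))

/-- ★ The AXIAL KINK of the hole `w` along axis `a`: `(2 d(w) − d(w + e_a) − d(w − e_a))/ρ` — the negated normalised second difference of `d`
along the lattice axis line through the hole (site–hole–site, spacing `ρ`). -/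
def hKink (ρ : ℝ) (d : (Fin 3 → ℤ) → ℝ) (w : Fin 3 → ℤ) (a : Fin 3) : ℝ :=
  (2 * d w - d (w + axisZ a) - d (w - axisZ a)) / ρ

/-- ★ The MAX-KINK of the hole `w`: the largest of its three axial kinks. -/
def hMaxKink (ρ : ℝ) (d : (Fin 3 → ℤ) → ℝ) (w : Fin 3 → ℤ) : ℝ :=
  Finset.univ.sup' Finset.univ_nonempty (hKink ρ d w)

/-- ★ The ATTRIBUTED AXIS of the hole `w`: the least axis attaining the max-kink (a GLOBAL tie-break, the same for every hole of the frame). -/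
def hAxis (ρ : ℝ) (d : (Fin 3 → ℤ) → ℝ) (w : Fin 3 → ℤ) : Fin 3 :=
  if hKink ρ d w 0 = hMaxKink ρ d w then 0 else if hKink ρ d w 1 = hMaxKink ρ d w then 1 else 2

/-- Two lattice indices lie on the same axis-`a` line: all other coordinates agree. -/
def SameLine (a : Fin 3) (w w' : Fin 3 → ℤ) : Prop := ∀ i, i ≠ a → w i = w' i

/-- ★ The LINE FIBRE of the marked hole `w` (marking `mk`): the marked holes on the axis line of `w` attributed to the same axis. -/
def lineFiber (ρ : ℝ) (d : (Fin 3 → ℤ) → ℝ) (mk : (Fin 3 → ℤ) → Prop) (w : Fin 3 → ℤ) : Set (Fin 3 → ℤ) :=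
  {w' | mk w' ∧ hAxis ρ d w' = hAxis ρ d w ∧ SameLine (hAxis ρ d w) w w'}

/-- ★ The KEY HOLE of a line fibre: marked, and lexicographically largest `(max-kink, −coordinate along the attributed axis)` in its fibre —
every nonempty fibre has exactly one. -/
def IsKey (ρ : ℝ) (d : (Fin 3 → ℤ) → ℝ) (mk : (Fin 3 → ℤ) → Prop) (w : Fin 3 → ℤ) : Prop :=
  mk w ∧ ∀ w' ∈ lineFiber ρ d mk w,
    hMaxKink ρ d w' < hMaxKink ρ d w ∨ (hMaxKink ρ d w' = hMaxKink ρ d w ∧ w (hAxis ρ d w) ≤ w' (hAxis ρ d w))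

/-- ★ The MARKED-HOLE COUNT of the line fibre of `w` (`Set.ncard`; the fibres met below are finite). -/
def lineCount (ρ : ℝ) (d : (Fin 3 → ℤ) → ℝ) (mk : (Fin 3 → ℤ) → Prop) (w : Fin 3 → ℤ) : ℕ :=
  (lineFiber ρ d mk w).ncard

end HoleCalculus

/-! ## §L2 The leaf (LS): the cubic frame of the class (crystallography) -/

section CubicFrame

/-- ★ `(c₀, f, ρ)` is a CUBIC FRAME OF the reference `P` for the pair window `(r₁, r₂]`: (i) the sites of `P` are exactly the lattice points of even
coordinate sum; (ii) every mid pair `(y, z)` (`r₁ < d ≤ r₂`) is an axis-antipodal pair of poles `c ∓ ρ f_a` / `c ± ρ f_a` of the frame octahedron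
centred at a lattice point `c = cubicPt w` of ODD coordinate sum (an octahedral hole), and the sites of its octahedron (`InOct`) are exactly the six
vertices `c ± ρ f_i`.  (All octahedra of the reference are lattice translates of ONE frame octahedron: the commensurability that makes kinks on a
common axis line comparable.) -/
def IsCubicFrameOf (P : PeriodicConfiguration 3) (r₁ r₂ : ℝ) (c₀ : E3) (f : Fin 3 → E3) (ρ : ℝ) : Prop :=
  (∀ x : E3, x ∈ P.points ↔ ∃ w : Fin 3 → ℤ, Even (∑ i, w i) ∧ x = cubicPt c₀ f ρ w) ∧
    ∀ y z : E3, y ∈ P.points → z ∈ P.points → r₁ < dist y z → dist y z ≤ r₂ →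
      ∃ (w : Fin 3 → ℤ) (a : Fin 3) (b : Bool), Odd (∑ i, w i) ∧
        y = octVertex (cubicPt c₀ f ρ w) f ρ a (!b) ∧ z = octVertex (cubicPt c₀ f ρ w) f ρ a b ∧
          ∀ x : E3, InOct P r₁ y z x ↔ ∃ (i : Fin 3) (b' : Bool), x = octVertex (cubicPt c₀ f ρ w) f ρ i b'

/-- ★★★ **(LS) THE CUBIC FRAME OF THE CLASS** (crystallography; configuration-free in `C`, `X`): every reference of the class `cls` admits a cubic
frame `(c₀, f, ρ)` — `f` orthonormal, half-diagonal `ρ ∈ [ρlo, ρhi]` — for the pair window `(r₁, r₂]` (`IsCubicFrameOf`).  For `cls₀` (cubic fcc images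
with nearest-neighbour distance `a₀√2`), `r₁ = 6/5`, `r₂ = 3/2`, `[ρlo, ρhi] = [0.679, 0.691]`: TRUE — the fcc lattice is `ρ·D₃ = {ρw : Σ wᵢ even}`
with `ρ = a/√2 = a₀ ≈ 0.6868`, the mid pairs are `±2ρ e_a` (the only even vectors of squared length in `((6/5)/ρ)², ((3/2)/ρ)²] ∋ 4`), their
midpoints the odd points, and `InOct` = the six odd-point neighbours (window arithmetic `(1.2/ρ)² < 3.13`).
[CRYSTALLOGRAPHY · KNOWN · TRUE · ATTACKABLE-S: Literature `FlatleyTheil2015.exists_linearIsometryEquiv_image_fccLattice` (`A '' fccLattice =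
fccStacking 1 √(2/3)`), tree `IsCubicFccImage`/`barlowStacking`, `Fcc.a0` window lemmas, and the vector arithmetic of `IsFramedOct`'s proof route —
why it might fail: only by a slip in the `ρ`-window (`a₀ ∉ [0.679, 0.691]` is excluded by the tree's `A0Plus`-type bounds)] -/
def CubicFrameQ (cls : Set E3 → Prop) (r₁ r₂ ρlo ρhi : ℝ) : Prop :=
  ∀ P : PeriodicConfiguration 3, cls P.points →
    ∃ (c₀ : E3) (f : Fin 3 → E3) (ρ : ℝ), Orthonormal ℝ f ∧ ρlo ≤ ρ ∧ ρ ≤ ρhi ∧ IsCubicFrameOf P r₁ r₂ c₀ f ρ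

end CubicFrame

/-! ## §L3 The line-excess table and the leaf (LB): the key-cell line lemma (finite-dimensional) -/

section LineCharge

/-- The LINE-EXCESS TABLE (units of `c_T`), two rows of 13 column entries (kink columns of `capK`: `J < ½`, `[½, 1)`, the `0.1`-columns on `[1, 2)`,
`≥ 2`): row 0 = exactly TWO marked holes on the line, row 1 = THREE OR MORE.  Entry = `⌈1.05 × (line-DP maximum) + 0.3⌉_{0.1}` for columns `2–10`,
and `0` for the key columns `11, 12` (`J_key ≥ 1.9`: no second marked hole fits — PROVED-grade: after a slope drop `≥ 1.9` the depth falls below the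
table (`< 93.5`) before the slope can recover to `0`, comparison with the single-point extremal `d(s)² = d₀² + 2 s d₀ u + s²`: loss `≥ 0.56 d₀ ≥ 79`
vs the `47` available).  Line DP `num/zkey.py` (g81): hole-event value iteration over (depth, slope) with the two PROVED line constraints of the
distance function (`1`-Lipschitz, `d(i+1)² + d(i−1)² ≤ 2d(i)² + 2ρ²`), charged kinks at the column lower ends `≤` the key column, free steering kinks,
row of a continuation hole = the table maximum over its min-depth window, window `2(R_N + ρ)`, `ρ ∈ {0.679, 0.6868, 0.691}`, key depth band
`[88, 141]`; raw maxima (n = 2 / n ≥ 3): col 2: `8.4 / 16.8`, 3: `11.0 / 16.8`, 4: `15.6`, 5: `17.5`, 6: `21.8`, 7: `25.3`, 8: `33.3`, 9: `41.9`,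
10: `2.1`, 11–12: `0`; ONE marked hole (n ≤ 1): excess `0` by definition. -/
def lineExcessRows : List (List ℚ) :=
  [[0, 0, 9.2, 11.9, 16.7, 18.7, 23.2, 26.9, 35.3, 44.3, 2.6, 0, 0],
   [0, 0, 18, 18, 16.7, 18.7, 23.2, 26.9, 35.3, 44.3, 2.6, 0, 0]]

/-- ★ The LINE EXCESS `E(j, n)` of a key hole of kink column `j` on a line carrying `n` marked holes: `0` for `n ≤ 1`, else the table row `n = 2` /
`n ≥ 3` (clamped at `0` from below, a no-op on the table). -/
def lineExcess (j n : ℕ) : ℝ :=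
  if n ≤ 1 then 0 else max 0 ((((lineExcessRows.getD (if n = 2 then 0 else 1) []).getD j 0 : ℚ) : ℝ))

/-- The line excess is non-negative. [formal bookkeeping] -/
theorem lineExcess_nonneg (j n : ℕ) : 0 ≤ lineExcess j n := by
  unfold lineExcess
  split_ifs
  · exact le_rfl
  · exact le_max_left _ _
  · exact le_max_left _ _

/-- ★ The KEY CHARGE of the hole `w` (depth function `d`, marking `mk`): `capK(min-depth, max-kink) + E(kink column, marked-hole count of its line
fibre)` if `w` is the key hole of its fibre, else `0`. -/
def keyCharge (ρ : ℝ) (d : (Fin 3 → ℤ) → ℝ) (mk : (Fin 3 → ℤ) → Prop) (w : Fin 3 → ℤ) : ℝ :=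
  if IsKey ρ d mk w then capK (hDepthMin d w) (hMaxKink ρ d w) + lineExcess (capKCol (hMaxKink ρ d w)) (lineCount ρ d mk w) else 0

/-- The key charge is non-negative. [formal bookkeeping] -/
theorem keyCharge_nonneg (ρ : ℝ) (d : (Fin 3 → ℤ) → ℝ) (mk : (Fin 3 → ℤ) → Prop) (w : Fin 3 → ℤ) : 0 ≤ keyCharge ρ d mk w := by
  unfold keyCharge
  split_ifs
  · exact add_nonneg (capK_nonneg _ _) (lineExcess_nonneg _ _)
  · exact le_rfl

/-- ★★★ **(LB) THE KEY-CELL LINE LEMMA** (finite-dimensional; no configuration, no energy): for every half-diagonal `ρ ∈ [ρlo, ρhi]`, every cubic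
frame `(c₀, f, ρ)`, every DEPTH FUNCTION `d : ℤ³ → ℝ≥0` obeying along the three axis directions the two line constraints of a distance function
sampled at spacing `ρ` — `|d(w + e_a) − d(w)| ≤ ρ` and `d(w + e_a)² + d(w − e_a)² ≤ 2 d(w)² + 2ρ²` (tree `infDist_sq_secondDiff_le`) — every centre `x`
and every MARKING `mk` of odd lattice points within `R_N + ρ` of `x` whose holes sit in the charged part of the table (row `≥ 1`, kink column `≥ 2`):
the total table charge of the marked holes is at most the total KEY CHARGE — per axis line and attributed axis, the charge of the key hole (the
marked hole of largest max-kink, nearest-first) plus the line excess `E(column of the key, number of marked holes on the line)`: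
`Σ_{w marked} capK(hDepthMin w, hMaxKink w) ≤ Σ_w keyCharge w`.  Reduces (fibrewise over the lines `{w + 2k e_a}`; on a fibre every hole is
attributed to the line's axis, so its max-kink IS its kink along the line, its min-depth lies in `[d(w) − ρ, min(d(w ± e_a))]`, and marked holes
are `≤ 2(R_N + ρ)/ρ` steps apart) to the ONE-DIMENSIONAL statement certified census-level by the line DP `num/zkey.py` (docstring of
`lineExcessRows`).  [TABLE · NEW · TRUE-leaning (grid DP, nearest rounding `0.25 × 0.01`, margin `5 % + 0.3 c_T`; key columns 11–12 exact `0` by the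
extremal comparison) · FINITE-DIMENSIONAL (a 1D optimal-control problem over `≤ 118` steps with `2` state variables) · INSTRUMENTABLE ·
ATTACKABLE-M: interval version of the same DP (outward rounding on a `(d, u)` grid, monotone envelopes) = a certificate by `decide`-style
evaluation, plus the elementary fibre decomposition — why it might fail: a depth profile steering through the table's peak rows between two charged
kinks more profitably than the `0.05`-grid of free kinks found (cost `≤` a few `%`, inside the margin), or an error in the DP's site-kink omission
(kinks at sites between holes only lower the slope earlier: dominated up to `O(ρ/d) = 1 %`)] -/
def LineChargeQ (R_N ρlo ρhi : ℝ) : Prop :=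
  ∀ ρ : ℝ, ρlo ≤ ρ → ρ ≤ ρhi → ∀ (c₀ : E3) (f : Fin 3 → E3), Orthonormal ℝ f → ∀ d : (Fin 3 → ℤ) → ℝ,
    (∀ w, 0 ≤ d w) → (∀ w a, |d (w + axisZ a) - d w| ≤ ρ) →
    (∀ w a, d (w + axisZ a) ^ 2 + d (w - axisZ a) ^ 2 ≤ 2 * d w ^ 2 + 2 * ρ ^ 2) →
    ∀ (x : E3) (mk : (Fin 3 → ℤ) → Prop),
      (∀ w, mk w → Odd (∑ i, w i) ∧ dist x (cubicPt c₀ f ρ w) ≤ R_N + ρ ∧ 1 ≤ capKRow (hDepthMin d w) ∧ 2 ≤ capKCol (hMaxKink ρ d w) ∧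
        hDepthMin d w < 140) →
      ∑ᶠ w, (if mk w then capK (hDepthMin d w) (hMaxKink ρ d w) else 0) ≤ ∑ᶠ w, keyCharge ρ d mk w

end LineCharge

/-! ## §L4 The line pairs, the marked holes, the line load, the line moment and the residual leaf (M_L) -/

section LineLoad

variable (ϱχ : ℝ) {m : ℕ} (D : Fin m → Set E3) (σ : Fin m → Bool)

/-- ★ A LINE PAIR: a χ-free ordered mid pair whose octahedron sits in the charged part of the table (min-depth row `≥ 1`, i.e. `≥ 93.5`, kink
column `≥ 2`, i.e. max-kink `≥ 1`, and min-depth below the table's end `140`) — the pairs whose frozen sixth-costs are re-booked on lines; all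
other heavy pairs stay booked hole-wise (those beyond `140` at frozen cost `0`). -/
def IsLinePair (P : PeriodicConfiguration 3) (C : Set E3) (r₁ : ℝ) (y z : E3) : Prop :=
  OctChiFree ϱχ D P r₁ y z ∧ 1 ≤ capKRow (octMinDepth C P r₁ y z) ∧ 2 ≤ capKCol (octMaxKink C P r₁ y z) ∧ octMinDepth C P r₁ y z < 140

/-- ★ The LATTICE DEPTH FUNCTION of `C` in the frame `(c₀, f, ρ)`: `w ↦ dist(cubicPt w, C)`. -/
def latDepth (C : Set E3) (c₀ : E3) (f : Fin 3 → E3) (ρ : ℝ) : (Fin 3 → ℤ) → ℝ :=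
  fun w => Metric.infDist (cubicPt c₀ f ρ w) C

/-- ★ The MARKED HOLES at `x`: odd lattice indices `w` whose lattice point is the centre of the octahedron of some HEAVY ACTIVE LINE PAIR `(y', z')`
with `dist x y' ≤ R_N` (the pairs entering the frozen load at `x`). -/
def IsMarked (R_N r_f dK dstar κ c_T cχ : ℝ) (P : PeriodicConfiguration 3) (C X : Set E3) (τ ϱ r₁ r₂ : ℝ) (c₀ : E3) (f : Fin 3 → E3)
    (ρ : ℝ) (x : E3) (w : Fin 3 → ℤ) : Prop :=
  Odd (∑ i, w i) ∧ ∃ y' z' : E3, HeavyActive ϱχ D σ r_f dK dstar κ c_T cχ P C X τ ϱ r₁ r₂ y' z' ∧ IsLinePair ϱχ D P C r₁ y' z' ∧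
    dist x y' ≤ R_N ∧ octCentre y' z' = cubicPt c₀ f ρ w

/-- ★ The REST LOAD at `x`: the frozen sixth-costs of the heavy active pairs near `x` that are NOT line pairs (χ-touching pairs: raw `frameVal/6`;
χ-free pairs below row `1` or below column `2`: `capVal/6`), booked hole-wise exactly as in `frozenLoad`. -/
def restLoad (R_N unit r_f dK dstar κ c_T cχ : ℝ) (P : PeriodicConfiguration 3) (C X : Set E3) (τ ϱ r₁ r₂ : ℝ) (x : E3) : ℝ :=
  ∑ᶠ p : E3 × E3,
    if (HeavyActive ϱχ D σ r_f dK dstar κ c_T cχ P C X τ ϱ r₁ r₂ p.1 p.2 ∧ dist x p.1 ≤ R_N) ∧ ¬IsLinePair ϱχ D P C r₁ p.1 p.2 then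
      (1 / 6) * frozenCost ϱχ D σ unit P C X τ ϱ r₁ p.1 p.2
    else 0

/-- ★ The **LINE LOAD** at `x` in the frame `(c₀, f, ρ)`: the rest load plus `unit ×` the total KEY CHARGE of the marked holes at `x` — per axis line
ONE table charge (the key hole's) plus the line excess of the line's marked-hole count, instead of one table charge per χ-free octahedron. -/
def lineLoad (R_N unit r_f dK dstar κ c_T cχ : ℝ) (P : PeriodicConfiguration 3) (C X : Set E3) (τ ϱ r₁ r₂ : ℝ) (c₀ : E3) (f : Fin 3 → E3)
    (ρ : ℝ) (x : E3) : ℝ :=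
  restLoad ϱχ D σ R_N unit r_f dK dstar κ c_T cχ P C X τ ϱ r₁ r₂ x +
    unit * ∑ᶠ w : Fin 3 → ℤ, keyCharge ρ (latDepth C c₀ f ρ) (IsMarked ϱχ D σ R_N r_f dK dstar κ c_T cχ P C X τ ϱ r₁ r₂ c₀ f ρ x) w

/-- ★ The **LINE MOMENT** `Ξ_L(y)`: the pool-weighted line loads of the reference sites within `R_N` of `y`. -/
def lineMoment (R_N unit r_f dK dstar κ c_T cχ : ℝ) (P : PeriodicConfiguration 3) (C X : Set E3) (τ ϱ r₁ r₂ : ℝ) (c₀ : E3) (f : Fin 3 → E3)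
    (ρ : ℝ) (y : E3) : ℝ :=
  ∑ᶠ x : E3, if x ∈ P.points ∧ dist x y ≤ R_N then
    pool ϱχ D σ r_f dK dstar κ c_T cχ P C X τ ϱ r₁ r₂ x * lineLoad ϱχ D σ R_N unit r_f dK dstar κ c_T cχ P C X τ ϱ r₁ r₂ c₀ f ρ x else 0

variable {ϱχ D σ}

/-- ★★★ **(M_L) THE LINE MATCHING** — the residual of NODE 82: for every reference of the class with a CUBIC FRAME `(c₀, f, ρ₀)` (`f` orthonormal,
`ρ₀ ∈ [ρlo, ρhi]`, `IsCubicFrameOf`) and every HEAVY ACTIVE CREASED ordered mid pair `(y, z)`: `0 < Π(y)` and `Ξ_L(y) ≤ Π(y)²` — the ball pool of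
NODE 79 against the LINE MOMENT, in which the χ-free table charges of the frozen moment are re-booked PER AXIS LINE of the frame: each line through
the ball carries the charge of ONE key hole (its largest kink, i.e. the fold where the medial sheet crosses the line) plus a count-indexed excess that
VANISHES when the line meets one marked hole.  On the binding single-sheet families (slab / tilted slab / rational combs) every axis line crosses the
sheet once, so `Ξ_L = Ξ_F` there: census = NODE 81's (`num/zfrozen.py` g80 + `RESULTS-g81.md` §C): worst `0.967` at `(L, c) = (118, 80.7)` phase `0`,
tilted combs `(1,0,4)`: `0.906`, `(1,0,8)`: `0.95`, `(210)`: `0.39`, `(111)`: `0.18`.  ONE-SIDED: `Ξ_F ≤ Ξ_L` always (PROVED below from (LS), (LB)),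
so (M_L) is (M_F) with the kink budget CASHED per line — EQUAL to (M_F) on every censused family (one marked hole per line), STRONGER by the (LB)-slack
(at most one excess `E(j, n) ≤ 44.3 c_T` per multi-hole line; `0` for key columns 11–12, where (LB) shows that a second charged hole on the line cannot
exist: after a kink `J ≥ 1.9` the depth falls below the table before the slope can turn again).  [RESIDUAL-DECIDING · NEW as typed · TRUE-leaning,
THIN (margin `1.034` on the slab family, inherited; T-junction family: `0.634`, margin `1.58`, `Ξ_L = Ξ_F` there — RESULTS-g81 §E) · LOCAL ·
INSTRUMENTABLE (census-1: wedge-roof / X-junction families at `R_N = 80` through `lineLoad`) · ATTACKABLE-L; door [COLUMN BUDGET]: per axis line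
the charge is now a function of ONE cell and ONE count, and the pool of the sites on the two neighbouring site lines is a 1D profile of the same depth
function — the matching becomes a sum over lines of (key charge) against (column pool), a 1D variational inequality per direction plus the
isoperimetry of the ball — why it might fail: a void whose medial sheet meets the ball in TWO well-separated strong folds on many parallel lines
(two sheets at distance `< R_N` but `> 2ρ·`budget), each line then paying `capK + E(j, 2) ≈ 1.9 capK` while the pool is that of the sites between
the sheets only]  «Why novel»: the unit of account changes from the octahedron to the LATTICE LINE — the kink budget of the distance function
(semiconcavity) is spent once per line, which no hole-wise ledger (NODEs 75–81) can express. -/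
def LineMatchingQ' (cls : Set E3 → Prop) (R_N r_f dK dstar κ c_T cχ unit : ℝ) (s lam ℓ τ ϱ ϱχ r₁ r₂ ρlo ρhi : ℝ) : Prop :=
  ∀ (P : PeriodicConfiguration 3) (C X : Set E3) (m : ℕ) (D : Fin m → Set E3) (σ : Fin m → Bool),
    IsSeparatedRef s P → IsLabelledRef lam ℓ P → cls P.points → IsForceFree P → IsSiteStressFree P →
    IsInvariantSet P C → IsInvariantSet P X → (∀ i, IsInvariantSet P (D i)) → (∀ i, IsConvexPieces (2 * ϱχ) (D i)) →
    IsFramedOct P r₁ r₂ ρlo ρhi →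
    ∀ (c₀ : E3) (f : Fin 3 → E3) (ρ₀ : ℝ), Orthonormal ℝ f → ρlo ≤ ρ₀ → ρ₀ ≤ ρhi → IsCubicFrameOf P r₁ r₂ c₀ f ρ₀ →
    ∀ y z : E3, HeavyActive ϱχ D σ r_f dK dstar κ c_T cχ P C X τ ϱ r₁ r₂ y z → ¬OctTame r_f C P r₁ y z →
      0 < ballPool ϱχ D σ R_N r_f dK dstar κ c_T cχ P C X τ ϱ r₁ r₂ y ∧
        lineMoment ϱχ D σ R_N unit r_f dK dstar κ c_T cχ P C X τ ϱ r₁ r₂ c₀ f ρ₀ y ≤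
          ballPool ϱχ D σ R_N r_f dK dstar κ c_T cχ P C X τ ϱ r₁ r₂ y ^ 2

end LineLoad

end Summit.AtomisticToContinuum.Crystallization.Theorems.ChargedEnergyGapChartDial
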